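import Mathlib
import Summits.ValiantsHypothesis.ValiantsHypothesis.Theses.FeketeSOS

/-!
# `FeketeBoundedFanin` — negative lemmas: exactly `s₀ = 0, 1` are vacuous; `s₀ = 2` is inhabited with ceiling `2p + 2`

Crux `stmt-ValiantsHypothesis-3998` = `Summit.ValiantsHypothesis.ValiantsHypothesis.Theses.FeketeSOS.FeketeBoundedFanin`
(route FeketeSOS, rank 5).  Standing disprover (cdisprove gen 1, cycle 1), `Cruxes/FeketeBoundedFanin/Disproof.lean` §B.
`𝔉⟮p⟯` below is a local NOTATION for the crux's literal right-hand side `∑_{m<p} C (legendreSym p m) X^m` (this file introduces no definitions).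

* `C_mul_sq_ne_fekete` — `F_p` is not `c·g²` (`X ∥ F_p`: coefficient `0` at `X⁰`, `χ_p(1) = 1` at `X¹`);
  `feketeBoundedFanin_vacuous_at_zero`, `feketeBoundedFanin_vacuous_at_one` — the crux's representation hypothesis is
  unsatisfiable for `s₀ = 0, 1` (those instances are vacuously true and carry no information).
* `feketeBoundedFanin_hypotheses_inhabited` — for EVERY prime `p` the hypotheses are satisfiable at `s₀ = 2`
  (`F_p = ¼(F_p+1)² − ¼(F_p−1)²`, degrees `≤ p−1 ≤ p²`, support-sum `≤ 2p+2`): every case `s₀ ≥ 2` has content and the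
  minimal support-sum for fixed `s₀ ≥ 2` lies between the claimed `p^{1/2+δ}` and the trivial ceiling `2p + 2`
  (the `s₀ = 2` truth is `≥ (p+3)/2` by the sibling crux's char-`p` lever and `≈ 0.74p…p` numerically for `p ≤ 29`).
[folklore]
-/

namespace Summit.ValiantsHypothesis.ValiantsHypothesis.Theorems.FeketeBoundedFanin.Negative

open Polynomial Finset
open scoped BigOperators

noncomputable section

/-! Local notations (no definitions are introduced by this file; every statement is over Mathlib terms and the crux's
literal right-hand side). -/

/-- `𝔸⟮k⟯ = X · ∑_{a<k} X^a` (k monomials). -/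
local notation3 "𝔸⟮" k "⟯" => (∑ a ∈ Finset.range k, (Polynomial.X : Polynomial ℂ) ^ (a + 1))
/-- `𝔹⟮k⟯ = ∑_{b<k} X^{kb}` (k monomials). -/
local notation3 "𝔹⟮" k "⟯" => (∑ b ∈ Finset.range k, (Polynomial.X : Polynomial ℂ) ^ (k * b))
/-- `ℭ⟮k, r⟯ = X^{k²+1} ∑_{j<r} X^j` (r monomials). -/
local notation3 "ℭ⟮" k ", " r "⟯" => (∑ j ∈ Finset.range r, (Polynomial.X : Polynomial ℂ) ^ (k * k + 1 + j))
/-- `𝕌⟮p⟯ = ∑_{m<p} [m ≠ 0] X^m`, the all-ones target typed like the crux's `F_p`. -/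
local notation3 "𝕌⟮" p "⟯" => (∑ m ∈ Finset.range p, Polynomial.C ((if m = 0 then (0 : ℤ) else 1 : ℤ) : ℂ) * (Polynomial.X : Polynomial ℂ) ^ m)
/-- `𝔉⟮p⟯ = F_p = ∑_{m<p} (m|p) X^m`, the crux's literal right-hand side. -/
local notation3 "𝔉⟮" p "⟯" => (∑ m ∈ Finset.range p, Polynomial.C ((legendreSym p m : ℤ) : ℂ) * (Polynomial.X : Polynomial ℂ) ^ m)


/-- Support card is subadditive over finite sums. [folklore] -/
private theorem card_support_sum_le {ι : Type*} (s : Finset ι) (q : ι → ℂ[X]) :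
    (∑ i ∈ s, q i).support.card ≤ ∑ i ∈ s, (q i).support.card := by
  classical
  induction s using Finset.induction_on with
  | empty => simp
  | @insert a s ha ih =>
    rw [Finset.sum_insert ha, Finset.sum_insert ha]
    exact (Finset.card_le_card Polynomial.support_add).trans
      ((Finset.card_union_le _ _).trans (Nat.add_le_add le_rfl ih))

/-- `C ¼ · 4 = 1` in `ℂ[X]`. [folklore] -/
private theorem C_inv_four_mul_four : (C (4⁻¹ : ℂ)) * 4 = (1 : ℂ[X]) := by
  rw [← Polynomial.C_ofNat 4, ← map_mul, inv_mul_cancel₀ (by norm_num : (4 : ℂ) ≠ 0), map_one]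

/-- `1` has at most one monomial. [folklore] -/
private theorem card_support_one_le : (1 : ℂ[X]).support.card ≤ 1 := by
  simpa using (card_support_C_mul_X_pow_le_one (R := ℂ) (c := 1) (n := 0))

/-- Support card is subadditive. [folklore] -/
private theorem card_support_add_le' (P Q : ℂ[X]) : (P + Q).support.card ≤ P.support.card + Q.support.card :=
  (Finset.card_le_card support_add).trans (Finset.card_union_le _ _)

/-- Support card is subadditive (difference). [folklore] -/
private theorem card_support_sub_le' (P Q : ℂ[X]) : (P - Q).support.card ≤ P.support.card + Q.support.card := by
  rw [sub_eq_add_neg]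
  simpa [support_neg] using card_support_add_le' P (-Q)

/-! ## §B Non-vacuity and the trivial ceiling `2p + 2` at `s₀ = 2` -/

/-- `deg F_p ≤ p − 1`. [folklore] -/
theorem natDegree_fekete_le (p : ℕ) [Fact p.Prime] : (𝔉⟮p⟯).natDegree ≤ p - 1 := by
  exact natDegree_sum_le_of_forall_le _ _ fun m hm =>
    (natDegree_C_mul_X_pow_le _ _).trans (by simp at hm; omega)

/-- `F_p` has at most `p` monomials. [folklore] -/
theorem card_support_fekete_le (p : ℕ) [Fact p.Prime] : (𝔉⟮p⟯).support.card ≤ p := by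
  have h := card_support_sum_le (range p) (fun m => C ((legendreSym p (m : ℤ) : ℤ) : ℂ) * (X : ℂ[X]) ^ m)
  have h2 : ∑ m ∈ range p, (C ((legendreSym p (m : ℤ) : ℤ) : ℂ) * (X : ℂ[X]) ^ m).support.card ≤ ∑ m ∈ range p, 1 :=
    Finset.sum_le_sum fun m _ => card_support_C_mul_X_pow_le_one
  simp only [Finset.sum_const, Finset.card_range, smul_eq_mul, mul_one] at h2
  exact h.trans h2

/-- `[X⁰] F_p = χ_p(0) = 0`. [folklore] -/
theorem coeff_fekete_zero (p : ℕ) [Fact p.Prime] : (𝔉⟮p⟯).coeff 0 = 0 := by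
  simp

/-- `[X¹] F_p = χ_p(1) = 1`. [folklore] -/
theorem coeff_fekete_one (p : ℕ) [Fact p.Prime] : (𝔉⟮p⟯).coeff 1 = 1 := by
  have hp : 1 < p := (Fact.out : p.Prime).one_lt
  simp [hp]

/-- `F_p` is not a constant times a square: `X ∥ F_p` (coefficient `0` at `X⁰`, `χ_p(1) = 1` at `X¹`). [folklore] -/
theorem C_mul_sq_ne_fekete (p : ℕ) [Fact p.Prime] (c : ℂ) (g : ℂ[X]) : C c * g ^ 2 ≠ 𝔉⟮p⟯ := by
  intro h
  have h0 : (C c * g ^ 2).coeff 0 = 0 := by rw [h, coeff_fekete_zero]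
  have h1 : (C c * g ^ 2).coeff 1 = 1 := by rw [h, coeff_fekete_one]
  rw [coeff_C_mul, pow_two, mul_coeff_zero] at h0
  rcases mul_eq_zero.mp h0 with hc | hg
  · rw [hc, map_zero, zero_mul, coeff_zero] at h1
    exact zero_ne_one h1
  · have hg0 : g.coeff 0 = 0 := by
      rcases mul_eq_zero.mp hg with h' | h' <;> exact h'
    have hX : (X : ℂ[X]) ^ 2 ∣ C c * g ^ 2 :=
      dvd_mul_of_dvd_right (pow_dvd_pow_of_dvd (X_dvd_iff.mpr hg0) 2) _
    have := (X_pow_dvd_iff.mp hX) 1 (by norm_num)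
    rw [h1] at this
    exact one_ne_zero this

/-- **Vacuity at `s₀ = 0`**: the empty sum is `0 ≠ F_p`, so the crux's hypothesis is unsatisfiable there. [folklore] -/
theorem feketeBoundedFanin_vacuous_at_zero (p : ℕ) [Fact p.Prime] (c : Fin 0 → ℂ) (g : Fin 0 → ℂ[X]) :
    (∑ i, Polynomial.C (c i) * g i ^ 2) ≠ 𝔉⟮p⟯ := by
  intro h
  have h1 := congrArg (fun q => Polynomial.coeff q 1) h
  simp only [Finset.univ_eq_empty, Finset.sum_empty, coeff_zero, coeff_fekete_one] at h1
  exact zero_ne_one h1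

/-- **Vacuity at `s₀ = 1`**: `c·g² ≠ F_p`, so the crux's hypothesis is unsatisfiable there too; exactly the cases
`s₀ ≥ 2` carry content. [folklore] -/
theorem feketeBoundedFanin_vacuous_at_one (p : ℕ) [Fact p.Prime] (c : Fin 1 → ℂ) (g : Fin 1 → ℂ[X]) :
    (∑ i, Polynomial.C (c i) * g i ^ 2) ≠ 𝔉⟮p⟯ := by
  rw [Fin.sum_univ_one]
  exact C_mul_sq_ne_fekete p (c 0) (g 0)

/-- **Non-vacuity / trivial ceiling.**  For every prime `p` the hypotheses of `FeketeBoundedFanin` are satisfiable at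
`s₀ = 2`: `F_p = ¼(F_p+1)² − ¼(F_p−1)²` with degrees `≤ p − 1 ≤ p²` and support-sum `≤ 2p + 2`.  So every case
`s₀ ≥ 2` has content, and the minimal support-sum for fixed `s₀ ≥ 2` lies between the claimed `p^{1/2+δ}` and `2p+2`.
[folklore] -/
theorem feketeBoundedFanin_hypotheses_inhabited (p : ℕ) [Fact p.Prime] :
    ∃ (c : Fin 2 → ℂ) (g : Fin 2 → ℂ[X]), (∀ i, (g i).natDegree ≤ p ^ 2) ∧
      (∑ i, Polynomial.C (c i) * g i ^ 2) = ∑ m ∈ Finset.range p, Polynomial.C ((legendreSym p m : ℤ) : ℂ) * Polynomial.X ^ m ∧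
      (∑ i, (g i).support.card) ≤ 2 * p + 2 := by
  have hp : 2 ≤ p := (Fact.out : p.Prime).two_le
  have hF := natDegree_fekete_le p
  have hp22 : p - 1 ≤ p ^ 2 := (Nat.sub_le p 1).trans (Nat.le_self_pow two_ne_zero p)
  have h1 : (𝔉⟮p⟯ + 1).natDegree ≤ p ^ 2 := (natDegree_add_le _ _).trans (max_le (by omega) (by simp))
  have h2 : (𝔉⟮p⟯ - 1).natDegree ≤ p ^ 2 := (natDegree_sub_le _ _).trans (max_le (by omega) (by simp))
  have hsF := card_support_fekete_le p
  have hs1 : (𝔉⟮p⟯ + 1).support.card ≤ p + 1 :=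
    (card_support_add_le' _ _).trans (Nat.add_le_add hsF card_support_one_le)
  have hs2 : (𝔉⟮p⟯ - 1).support.card ≤ p + 1 :=
    (card_support_sub_le' _ _).trans (Nat.add_le_add hsF card_support_one_le)
  refine ⟨![4⁻¹, -4⁻¹], ![𝔉⟮p⟯ + 1, 𝔉⟮p⟯ - 1], ?_, ?_, ?_⟩
  · intro i
    fin_cases i
    exacts [h1, h2]
  · change _ = 𝔉⟮p⟯
    simp only [Fin.sum_univ_two, Matrix.cons_val_zero, Matrix.cons_val_one, map_neg]
    linear_combination (𝔉⟮p⟯) * C_inv_four_mul_four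
  · simp only [Fin.sum_univ_two, Matrix.cons_val_zero, Matrix.cons_val_one]
    omega

end

end Summit.ValiantsHypothesis.ValiantsHypothesis.Theorems.FeketeBoundedFanin.Negative
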